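import Mathlib
import HarnessLib

/-!
# HodgeLocusCensusProductCore — kernel-checked core of the PRODUCT (LOCALITY) THEOREM G (cell pub-hlocus, LEAD gen 27; ruling R-L21)
HONEST FRAMING: certified instances and evidence bearing on the general Hodge conjecture; no claim.

Structural helper of the Hodge-locus census; nothing here is used by, or claims anything about, `Summit.HodgeConjecture`.
Record: `data/ivhs/census/og81/PRODUCT-THEOREM-g27.md` §3.  THEOREM G there says: at the Fermat cubic, the Jacobian-ring pencil of a rational matching pair
is block-diagonal over degree distributions on the long cycles, a block being `(⊗ᵢ αᵢ) + μ (⊗ᵢ βᵢ)`, and if ONE factor is dead (`im αᵢ ∩ im βᵢ = 0`) the block has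
`ker((⊗α) + μ(⊗β)) = ker(⊗α) ∩ ker(⊗β)` for every `μ ≠ 0` (no first-order excess, no special values).  This file kernel-checks exactly the linear algebra of
that step over a field, for two tensor factors (the r-factor case is this one with the other factors grouped):

* `ker_add_smul_eq_of_range_inf_eq_bot` — if `range A ⊓ range B = ⊥` then `ker (A + μ • B) = ker A ⊓ ker B` for `μ ≠ 0`;
* `range_map_inf_range_map_eq_bot` — LEMMA G2 / THEOREM G core: `range f₁ ⊓ range g₁ = ⊥ → range (f₁ ⊗ f₂) ⊓ range (g₁ ⊗ g₂) = ⊥`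
  (proof: tensor the quotient map by `range f₁` on the right; it kills `range (f₁ ⊗ f₂)` and is injective on `range (g₁ ⊗ g₂) = range (mapIncl (range g₁) (range g₂))`
  by flatness, `TensorProduct.map_injective_of_flat_flat`);
* `ker_tensor_block_eq` — the block statement: `ker (f₁ ⊗ f₂ + μ • g₁ ⊗ g₂) = ker (f₁ ⊗ f₂) ⊓ ker (g₁ ⊗ g₂)` for `μ ≠ 0` whenever `range f₁ ⊓ range g₁ = ⊥`.
The DEADNESS of the single-cycle factors (Lemma G1: t = 0, (1,≥3), (2,≥4), (3,≥5)) is the Boolean-ring side and stays on paper (its pigeonhole is in `…LongCycleCore`, p331918).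
-/

namespace Summit.HodgeConjecture.HodgeConjecture.HodgeLocus.Census.ProductCore

open scoped TensorProduct

section Pencil

variable {K : Type*} [Field K] {V W : Type*} [AddCommGroup V] [Module K V] [AddCommGroup W] [Module K W]

/-- If the ranges of `A` and `B` meet in `0`, the kernel of `A + μ B` (`μ ≠ 0`) is `ker A ∩ ker B`. -/
theorem ker_add_smul_eq_of_range_inf_eq_bot (A B : V →ₗ[K] W) (h : LinearMap.range A ⊓ LinearMap.range B = ⊥)
    (μ : K) (hμ : μ ≠ 0) : LinearMap.ker (A + μ • B) = LinearMap.ker A ⊓ LinearMap.ker B := by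
  ext x
  simp only [LinearMap.mem_ker, LinearMap.add_apply, LinearMap.smul_apply, Submodule.mem_inf]
  constructor
  · intro hx
    have hA : A x ∈ LinearMap.range A ⊓ LinearMap.range B := by
      refine ⟨LinearMap.mem_range_self A x, ?_⟩
      have : A x = B ((-μ) • x) := by
        rw [LinearMap.map_smul, neg_smul]; exact eq_neg_of_add_eq_zero_left hx
      rw [this]; exact LinearMap.mem_range_self B _
    rw [h, Submodule.mem_bot] at hA
    refine ⟨hA, ?_⟩
    rw [hA, zero_add, smul_eq_zero] at hx
    exact hx.resolve_left hμ
  · rintro ⟨hA, hB⟩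
    rw [hA, hB, smul_zero, add_zero]

end Pencil

section Tensor

variable {K : Type*} [Field K]
variable {M N P Q : Type*} [AddCommGroup M] [Module K M] [AddCommGroup N] [Module K N]
  [AddCommGroup P] [Module K P] [AddCommGroup Q] [Module K Q]

/-- `range (f ⊗ g)` is the range of the inclusion `(range f) ⊗ (range g) → P ⊗ Q` (as in `…LongCycleCore`, restated to keep this file import-free). -/
theorem range_map_eq_range_mapIncl (f : M →ₗ[K] P) (g : N →ₗ[K] Q) :
    LinearMap.range (TensorProduct.map f g) =
      LinearMap.range (TensorProduct.mapIncl (LinearMap.range f) (LinearMap.range g)) := by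
  rw [TensorProduct.range_map, TensorProduct.range_mapIncl]

/-- LEMMA G2 / THEOREM G core (one dead factor kills the intersection): `range f₁ ⊓ range g₁ = ⊥ → range (f₁ ⊗ f₂) ⊓ range (g₁ ⊗ g₂) = ⊥`. -/
theorem range_map_inf_range_map_eq_bot (f₁ g₁ : M →ₗ[K] P) (f₂ g₂ : N →ₗ[K] Q)
    (h : LinearMap.range f₁ ⊓ LinearMap.range g₁ = ⊥) :
    LinearMap.range (TensorProduct.map f₁ f₂) ⊓ LinearMap.range (TensorProduct.map g₁ g₂) = ⊥ := by
  rw [← disjoint_iff, Submodule.disjoint_def]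
  intro x hx hx'
  set p : P →ₗ[K] P ⧸ LinearMap.range f₁ := (LinearMap.range f₁).mkQ with hp
  -- (p ⊗ Q) kills range (f₁ ⊗ f₂)
  have kill : (p.rTensor Q) x = 0 := by
    obtain ⟨y, rfl⟩ := hx
    rw [← LinearMap.comp_apply, LinearMap.rTensor_comp_map]
    have hpf : p.comp f₁ = 0 := by
      ext m
      simp only [LinearMap.comp_apply, LinearMap.zero_apply, hp, Submodule.mkQ_apply,
        Submodule.Quotient.mk_eq_zero]
      exact LinearMap.mem_range_self f₁ m
    rw [hpf, TensorProduct.map_zero_left, LinearMap.zero_apply]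
  -- (p ⊗ Q) is injective on range (g₁ ⊗ g₂) = range (mapIncl (range g₁) (range g₂))
  rw [range_map_eq_range_mapIncl] at hx'
  obtain ⟨z, rfl⟩ := hx'
  have hinj : Function.Injective
      ((p.rTensor Q).comp (TensorProduct.mapIncl (LinearMap.range g₁) (LinearMap.range g₂))) := by
    rw [TensorProduct.mapIncl, LinearMap.rTensor_comp_map]
    apply TensorProduct.map_injective_of_flat_flat
    · rw [← LinearMap.ker_eq_bot, LinearMap.ker_comp, hp, Submodule.ker_mkQ,
        ← Submodule.disjoint_iff_comap_eq_bot, disjoint_iff, inf_comm]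
      exact h
    · exact Submodule.injective_subtype _
  have hz : z = 0 := hinj (by rw [LinearMap.comp_apply, kill, map_zero])
  rw [hz, map_zero]

/-- THEOREM G, block form: for `μ ≠ 0` and one dead factor (`range f₁ ⊓ range g₁ = ⊥`),
`ker (f₁ ⊗ f₂ + μ • g₁ ⊗ g₂) = ker (f₁ ⊗ f₂) ⊓ ker (g₁ ⊗ g₂)` — no excess and no special value in the block. -/
theorem ker_tensor_block_eq (f₁ g₁ : M →ₗ[K] P) (f₂ g₂ : N →ₗ[K] Q)
    (h : LinearMap.range f₁ ⊓ LinearMap.range g₁ = ⊥) (μ : K) (hμ : μ ≠ 0) :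
    LinearMap.ker (TensorProduct.map f₁ f₂ + μ • TensorProduct.map g₁ g₂) =
      LinearMap.ker (TensorProduct.map f₁ f₂) ⊓ LinearMap.ker (TensorProduct.map g₁ g₂) :=
  ker_add_smul_eq_of_range_inf_eq_bot _ _ (range_map_inf_range_map_eq_bot f₁ g₁ f₂ g₂ h) μ hμ

/-- The same with the dead factor on the RIGHT (`range f₂ ⊓ range g₂ = ⊥`), via `TensorProduct.comm`. -/
theorem range_map_inf_range_map_eq_bot' (f₁ g₁ : M →ₗ[K] P) (f₂ g₂ : N →ₗ[K] Q)
    (h : LinearMap.range f₂ ⊓ LinearMap.range g₂ = ⊥) :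
    LinearMap.range (TensorProduct.map f₁ f₂) ⊓ LinearMap.range (TensorProduct.map g₁ g₂) = ⊥ := by
  have key := range_map_inf_range_map_eq_bot f₂ g₂ f₁ g₁ h
  have hr : ∀ (a : M →ₗ[K] P) (b : N →ₗ[K] Q), LinearMap.range (TensorProduct.map a b) =
      Submodule.map (TensorProduct.comm K Q P).toLinearMap (LinearMap.range (TensorProduct.map b a)) := by
    intro a b
    rw [← LinearMap.range_comp, ← TensorProduct.map_comp_comm_eq, LinearMap.range_comp,
      LinearEquiv.range, Submodule.map_top, LinearMap.range_eq_map]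
  rw [hr f₁ f₂, hr g₁ g₂, ← Submodule.map_inf (TensorProduct.comm K Q P).toLinearMap
        (TensorProduct.comm K Q P).injective, key, Submodule.map_bot]

end Tensor

end Summit.HodgeConjecture.HodgeConjecture.HodgeLocus.Census.ProductCore
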